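import Summits.QuantumFields.YangMills.Theorems.BalabanUVNodesN20CoreEdgeAtReadingOfRecord13CoPHV
import Summits.QuantumFields.YangMills.Theorems.BalabanUVNodesN21ShellSplitOfRecord13CoPHKeyed
import Summits.QuantumFields.YangMills.Theorems.BalabanUVNodesN21KeyedShellWeightShellZero
import Summits.QuantumFields.YangMills.Theorems.BalabanUVNodesN20TwoRunKeyedGoodFibre

/-!
# BalabanUVNodes ∕ N20 (NE7b) — the `hedge`-JOINT COMPANION, module 7: N19's core edge of the spine reading of record `crOfRecord₁₃At K₀ jcut sh` AT THE SHELL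
# SPLIT OF RECORD `sh := shellSplitOfRecord₁₃At N K₀ ρA ρB` (dag-n21-d, p591252 ∕ p592363) IS the sandwich of the two runs' TERM CORES «(2.18) term minus its own
# top-level shell part» — run A's `s` vs run B's ONE lifted term `liftSeq s` — and, read through dag-n21-d's §3b identity, the sandwich of the two runs' (2.18) terms
# RE-TESTED AT THE LOWERED THRESHOLD `ε_k(1 − ρ)`; the sign letter `hP0` of dag-n20-d's transfer is a THEOREM at this split

Cell `pub-ymgap` (HUMAN RULING D-0062 Track A; D-0149 width push), seat `pub-ymgap-dag-n20-w3` (WIDTH SEAT 3 of 3 on NODE n20 = NE7b) gen 2, CLAIM-1 ∕ INTENT-7 (pub-ymgap INBOX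
l.26152 ∕ l.26290).  Modules 1–6 of this seat (p584566 · p585901 · p587086 · p588556 · p589862 · p591464) typed the `hedge` face of n19-d B :169 at node U5d's σ-packed
two-run keys with dag-n20-d's persistence class `badKeysSigma … jcut` and a GENERIC shell split `sh`, down to «run A's dressed class weight of `s` vs run B's of `liftSeq s`,
minus the keyed shells» (module 5 `core_reading₁₃_iff_liftedTerm`).  dag-n21-d g9 has since INHABITED the one residual reading of `crOfRecord₁₃At` — the keyed shell split
`shellSplitOfRecord₁₃At N K₀ ρA ρB = (shellA₁₃ … ρA, shellB₁₃ … ρB)`, fibre sums of the TERM SHELL PART `shellWeightOfDatum₉ … ρ t s = ∫ χ_k^{ε_k}(s)·(1 − χ_k^{ε_k(1−ρ)}(s))·slot^t_s`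
(`Thm/BalabanUVNodesN21ShellSplitOfRecord13CoPHDefs`), with `0 ≤ σ ≤ cw` and ★★ `classWeight_sub_shellWeight_eq_lowered`: `cw(s) − σ(s) = ∫ χ_k^{ε_k(1−ρ)}(s)·slot^t_s`
(`Thm/BalabanUVNodesN21ShellSplitOfRecord13CoPH` §3b: «N19′'s object made definite»).  This module composes the two BY NAME.  Filed `--kind proof --supports
stmt-QuantumFields-20544 --as helper` (K3⁷ `SpineGivenEndpointR13SepCoPH`); COUNT-NEUTRAL.  [III] = [Balaban1988Convergent], [LF-I∕II] = [Balaban1989LargeFieldI∕II].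

WHAT IS PROVED (bookkeeping; every step a fibre identity, a finite-sum sign, or a rewrite along a landed lemma).
* §1 DICTIONARY + SIGN LETTER.  `shellA₁₃_keyA` ∕ `weightA₁₃_keyA`: at run A's own key `⟨K, kA s⟩` the keyed shell part ∕ class weight of record IS the term's (node U5d's
  `kA` is injective — module 1's `sum_filter_key_eq_of_injective`).  `shellB₁₃_keyA_of_Ω_one` ∕ `weightB₁₃_keyA_of_Ω_one`: under the flow hypothesis `RAgree`, on a run-A
  index with `Ω_1 = T_η` (in particular on N20's GOOD class) run B's keyed shell part ∕ class weight at `⟨K, kA s⟩` IS the term shell part ∕ class weight of the ONE lifted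
  index `liftSeq s` (n20-w2's `sum_filter_sigma_twoRunKeyB_keyA_eq_liftSeq`, p586099 ∕ p590572).  ★ `weightA₁₃_sub_shellA₁₃_nonneg` ∕ `weightB₁₃_sub_shellB₁₃_nonneg`:
  `0 ≤ weight − shell` at EVERY key, from the core provisos ALONE on the weight side (rows `zetaUnity` + `zetaAbs` ⇒ `0 ≤ ζ`: n20-w2's `zeta_nonneg_of_provisos₁₃CoPH`, p593923, over dag-n21-d's `zetaOfRecord_nonneg` ⇒
  dag-n21-d's `shellA₁₃_le_weightA₁₃ ∕ shellB₁₃_le_weightB₁₃`, p593341, with their `hζ0` letter discharged) plus F3's DISPLAYED (e1) integrability `hint` of the run's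
  top pieces `χ_k(s)·slot^t_s` (a theorem on the live-selector line: dag-n21-d's `integrable_topPieceA_of_liveSel ∕ …B…`, p593341 — consumed in the companion) — i.e. the sign letter `hP0` of dag-n20-d's `core_crOfRecord₁₃At ∕ …VAt` AT THE SPLIT OF RECORD is discharged.
* §2 ★★ `core_shellSplit₁₃_iff_termCore` (`(l₀, vol)`-generic; policy `1 ≤ jcut K ≤ K₀ + K` and widths `ρA ρB : ℕ → ℝ` DISPLAYED): `NE7.Core l₀ vol (classSet₁₃ …)
  (badClass₁₃ … jcut) (weightA₁₃ − shellA₁₃ ρA) (weightB₁₃ − shellB₁₃ ρB) δ` — the hypothesis `h` of dag-n20-d's transfer at `sh := shellSplitOfRecord₁₃At …`, classical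
  instance included — IFF for every `K` ONE `c` with, for all `|t| ≤ l₀` and every run-A (2.18) index `s` small-field at every level `≤ jcut K`,
  `e^{c − vol·δ K}·(cw_A(s) − σ_A(s)) ≤ cw_B(liftSeq s) − σ_B(liftSeq s) ≤ e^{c + vol·δ K}·(cw_A(s) − σ_A(s))` (module 5 + §1; loss-free).
  ★★ `core_shellSplit₁₃_iff_loweredTerm`: under (H-U) `LocalBgMeasurable`, `0 ≤ ε_k·ρ` per run and F3's (e1) integrability of both runs' top pieces, the same with each term
  core READ AS `∫ χ_k^{ε_k(1−ρ)}(Ω_k(·))·slot^t_k(·) dV_k` — so AT THE SPLIT OF RECORD the core-edge conjunct of K3⁷ v2's stub 2 asks EXACTLY: «the (2.18) term of `s` at cutoff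
  `K₀ + K` and of its lift `liftSeq s` at cutoff `K₀ + K + 1`, both re-tested at the lowered small-field threshold, agree up to `e^{c_K ∓ vol·δ_K}` with ONE `c_K` per `K` and
  `Σ δ_K < ∞`, on every history that is small-field at the levels `≤ jcut K`» — ONE-STEP ULTRAVIOLET STABILITY OF THE DRESSED (2.18) TERMS, index by index.
  The transfers to `crOfRecord₁₃At ∕ crOfRecord₁₃VAt` with the sign letter discharged are the companion `Thm/BalabanUVNodesN20CoreEdgeAtShellSplitOfRecordTransfer`.

(α) READING ∕ LOCATED banner: unchanged from modules 2∕4∕5 and dag-n20-d's header — `badClass₁₃` reads «old AND pending» iff the record's 𝐑-selector `θ.ppSel` is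
history-rewriting ((ρ2), the design); under an identity ∕ junk pin it is «ever created» (evidence #10 on stmt-QuantumFields-20544).  NC-NE7b-α UNRULED.  The widths
`ρA ∕ ρB` and the policy `jcut` are the PROVER'S DIALS (plan g81 LOCATED-1∕3 rulings (a), INBOX l.25727 ∕ l.26217): at `ρ ≡ 0` the shell parts vanish and §2 is module 5's
sandwich of the bare terms (n20-w2's LOCATED-2∕3).

HONEST FRAMING.  Count-neutral bookkeeping; nothing re-typed (dag-n21-d's FILE 1∕2, n20-w2's fibre lemma, module 5, dag-n20-d's reading — all BY NAME).  It proves NO estimate: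
the sandwich for the record's dressed terms IS N19's NE7 core on small-field-at-old-levels histories — NOT PRINTED for `d = 4` ([LF-II] p.356), NOT proved, NAMED OPEN; the
per-cube (M1) behind the shell side is dag-n21-d's displayed hypothesis, not touched here.  A6: §2 are `iff`s (LOCATED); §1's sign lemmas are unconditional in the weights
and display `hint`.  NE7 ∕ NE7b ∕ NE7c NOT PRINTED ∕ NOT PROVED; (α)-instance 0∕1; N19 ∕ N20 ∕ N21 NOT discharged; K3⁷ NOT closed; counts unmoved (typed 28∕28 · discharged
5∕27); no count claim.  One finite `𝕋⁴_{L^K}` programme at fixed `ε = L^{−K}` along two consecutive cutoffs, Bałaban AS PRINTED; the YM mass gap (Clay) is NOT proved by any of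
this — R4 closes the conditional finite-𝕋⁴ rung `BalabanLadder.UV` only; NOT ℝ⁴, NOT OS.  No `instance`, no `notation`, no `def`, no `sorry`, no private decls.  Sources (bookkeeping): [III] (2.1) p.254, (2.5) p.255, (2.17)–(2.18) p.257; [LF-I] (0.2)–(0.4) p.176, p.193; [LF-II] Thm 1 + (0.1) pp.355–356, (1.80) p.384;
[King1986] (3.10) p.656.
-/

noncomputable section

namespace Summit.QuantumFields.YangMills.BalabanUVNodes.N20CoreEdgeAtShellSplit

open Literature.MathematicalPhysics.QuantumFieldTheory.Balaban1983to89 Literature.MathematicalPhysics.QuantumFieldTheory.Balaban1983to89.T4Continuum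
open Literature.MathematicalPhysics.QuantumFieldTheory.Balaban1983to89.Node00
open scoped BigOperators
open MeasureTheory
open B14.Eq218Concrete Summit.QuantumFields.BalabanUV.T4Continuum.Spine
open YMDAG.UVSplit (crOfRecord₁₃At crOfRecord₁₃VAt crOfRecord₁₃ ShellSplit₁₃CoPH keyA₁₃ keyB₁₃ keyB₁₃_eq runA₁₃ runB₁₃ histA₁₃ histB₁₃ classSet₁₃
  weightA₁₃ weightB₁₃ badClass₁₃ core_crOfRecord₁₃At core_crOfRecord₁₃VAt)
open Summit.QuantumFields.YangMills.Theorems.N21ShellSplitOfRecord13CoPH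
open Summit.QuantumFields.YangMills.BalabanUVNodes.N21KeyedShellWeightShellZero (zeta_nonneg_of_provisos₁₃CoPH)
open Summit.QuantumFields.YangMills.BalabanUVNodes.N20CoreEdgeAtReading13 (core_reading₁₃_iff_liftedTerm)
open Summit.QuantumFields.YangMills.BalabanUVNodes.N20CoreEdgeTwoRunKeyed (sum_filter_key_eq_of_injective)
open Summit.QuantumFields.YangMills.BalabanUVNodes.N19TargetClassWeightsTwoRunKeyed (sigma_twoRunKeyA_injective)
open Summit.QuantumFields.YangMills.BalabanUVNodes.N20TwoRunKeyedGoodFibre (sum_filter_sigma_twoRunKeyB_keyA_eq_liftSeq)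
open Summit.QuantumFields.YangMills.BalabanUVNodes.N20CoreEdgeLiftedTerm (Ω_one_eq_univ_of_smallFieldHistory)

variable {F : T4Family} {N : ℕ} [NeZero N]
variable (θ : Stage13HParams F N) (hP : θ.Provisos₁₃CoPH F N) (K₀ : ℕ) (g₀ : ℕ → ℝ) (os : List (ULoop F))

/-! ## §1 The keyed shell parts of record at a run-A key are TERM shell parts; the sign letter of the core is a theorem -/

/-- **RUN A's KEYED SHELL PART OF RECORD AT THE KEY OF `s` IS THE TERM SHELL PART OF `s`** (node U5d's run-A σ-key is injective — no summation).
[cite: Balaban1988Convergent, (2.18) p.257; King1986, (3.10) p.656 (bookkeeping)] -/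
theorem shellA₁₃_keyA (ρ : ℕ → ℝ) (K : ℕ) (t : ℝ) (s : SeqOfRecord F θ.ν θ.τ9.M (histA₁₃ θ K₀ g₀ K) (K₀ + K) (K₀ + K)) :
    shellA₁₃ θ hP K₀ g₀ os ρ K t ⟨K, twoRunKeyA F θ.ν θ.τ9.M (histA₁₃ θ K₀ g₀ K) (K₀ + K) (K₀ + K) s⟩ =
      shellWeightOfDatum₉ F N θ.toStage9Params (datumOfRecord₁₃CoPH F N θ hP) g₀ os (runA₁₃ F K₀ g₀ K) (histA₁₃ θ K₀ g₀ K) (K₀ + K) (ρ K) t s := by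
  letI : ∀ Kc, DecidableEq (SiteSeqKey F Kc) := fun _ => Classical.decEq _
  unfold shellA₁₃
  exact sum_filter_key_eq_of_injective (kA := fun K => keyA₁₃ θ K₀ g₀ K) (fun K => sigma_twoRunKeyA_injective F θ.ν K₀ θ.τ9.M _ K) K _ s

/-- **RUN A's KEYED CLASS WEIGHT OF RECORD AT THE KEY OF `s` IS THE CLASS WEIGHT OF `s`.** [cite: Balaban1988Convergent, (2.18) p.257; King1986, (3.10) p.656 (bookkeeping)] -/
theorem weightA₁₃_keyA (K : ℕ) (t : ℝ) (s : SeqOfRecord F θ.ν θ.τ9.M (histA₁₃ θ K₀ g₀ K) (K₀ + K) (K₀ + K)) :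
    weightA₁₃ θ hP K₀ g₀ os K t ⟨K, twoRunKeyA F θ.ν θ.τ9.M (histA₁₃ θ K₀ g₀ K) (K₀ + K) (K₀ + K) s⟩ =
      classWeightOfDatum₉ F N θ.toStage9Params (datumOfRecord₁₃CoPH F N θ hP) g₀ os (runA₁₃ F K₀ g₀ K) (histA₁₃ θ K₀ g₀ K) (K₀ + K) t s := by
  letI : ∀ Kc, DecidableEq (SiteSeqKey F Kc) := fun _ => Classical.decEq _
  unfold weightA₁₃
  exact sum_filter_key_eq_of_injective (kA := fun K => keyA₁₃ θ K₀ g₀ K) (fun K => sigma_twoRunKeyA_injective F θ.ν K₀ θ.τ9.M _ K) K _ s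

/-- **ON A RUN-A INDEX WITH `Ω_1 = T_η`, RUN B's KEYED SHELL PART OF RECORD AT ITS KEY IS THE TERM SHELL PART OF THE LIFTED INDEX `liftSeq s`** (under `RAgree`, `0 < θ.τ9.M`,
`1 ≤ K₀ + K`; n20-w2's `sum_filter_sigma_twoRunKeyB_keyA_eq_liftSeq`). [cite: Balaban1988Convergent, (2.5) p.255, (2.18) p.257; King1986, (3.10) p.656 (bookkeeping)] -/
theorem shellB₁₃_keyA_of_Ω_one (hM : 0 < θ.τ9.M) {K : ℕ} (hR : RAgree F θ.ν (histA₁₃ θ K₀ g₀ K) (histB₁₃ θ K₀ g₀ K) (K₀ + K)) (hk : 1 ≤ K₀ + K)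
    (ρ : ℕ → ℝ) (t : ℝ) (s : SeqOfRecord F θ.ν θ.τ9.M (histA₁₃ θ K₀ g₀ K) (K₀ + K) (K₀ + K)) (hΩ : s.Ω 1 = Set.univ) :
    shellB₁₃ θ hP K₀ g₀ os ρ K t ⟨K, twoRunKeyA F θ.ν θ.τ9.M (histA₁₃ θ K₀ g₀ K) (K₀ + K) (K₀ + K) s⟩ =
      shellWeightOfDatum₉ F N θ.toStage9Params (datumOfRecord₁₃CoPH F N θ hP) g₀ os (runB₁₃ F K₀ g₀ K) (histB₁₃ θ K₀ g₀ K) (K₀ + K + 1) (ρ K) t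
        (liftSeq F θ.ν hM hR s) := by
  letI : ∀ Kc, DecidableEq (SiteSeqKey F Kc) := fun _ => Classical.decEq _
  letI : DecidableEq (Σ K, SiteSeqKey F (K₀ + K)) := Classical.decEq _
  unfold shellB₁₃
  have h := sum_filter_sigma_twoRunKeyB_keyA_eq_liftSeq F θ.ν K₀ hM (gA := fun K => histA₁₃ θ K₀ g₀ K) (gB := fun K => histB₁₃ θ K₀ g₀ K) hR hk
    (fun s' : SeqOfRecord F θ.ν θ.τ9.M (histB₁₃ θ K₀ g₀ K) (K₀ + K + 1) (K₀ + K + 1) =>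
      shellWeightOfDatum₉ F N θ.toStage9Params (datumOfRecord₁₃CoPH F N θ hP) g₀ os (runB₁₃ F K₀ g₀ K) (histB₁₃ θ K₀ g₀ K) (K₀ + K + 1) (ρ K) t s') s hΩ
  refine Eq.trans ?_ h
  refine Finset.sum_congr ?_ fun _ _ => rfl
  ext s'
  simp only [Finset.mem_filter, Finset.mem_univ, true_and, keyB₁₃_eq θ K₀ g₀ hM K s']

/-- **… AND SO IS RUN B's KEYED CLASS WEIGHT** (the lifted term's class weight). [cite: Balaban1988Convergent, (2.5) p.255, (2.18) p.257; King1986, (3.10) p.656 (bookkeeping)] -/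
theorem weightB₁₃_keyA_of_Ω_one (hM : 0 < θ.τ9.M) {K : ℕ} (hR : RAgree F θ.ν (histA₁₃ θ K₀ g₀ K) (histB₁₃ θ K₀ g₀ K) (K₀ + K)) (hk : 1 ≤ K₀ + K)
    (t : ℝ) (s : SeqOfRecord F θ.ν θ.τ9.M (histA₁₃ θ K₀ g₀ K) (K₀ + K) (K₀ + K)) (hΩ : s.Ω 1 = Set.univ) :
    weightB₁₃ θ hP K₀ g₀ os K t ⟨K, twoRunKeyA F θ.ν θ.τ9.M (histA₁₃ θ K₀ g₀ K) (K₀ + K) (K₀ + K) s⟩ =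
      classWeightOfDatum₉ F N θ.toStage9Params (datumOfRecord₁₃CoPH F N θ hP) g₀ os (runB₁₃ F K₀ g₀ K) (histB₁₃ θ K₀ g₀ K) (K₀ + K + 1) t
        (liftSeq F θ.ν hM hR s) := by
  letI : ∀ Kc, DecidableEq (SiteSeqKey F Kc) := fun _ => Classical.decEq _
  letI : DecidableEq (Σ K, SiteSeqKey F (K₀ + K)) := Classical.decEq _
  unfold weightB₁₃
  have h := sum_filter_sigma_twoRunKeyB_keyA_eq_liftSeq F θ.ν K₀ hM (gA := fun K => histA₁₃ θ K₀ g₀ K) (gB := fun K => histB₁₃ θ K₀ g₀ K) hR hk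
    (fun s' : SeqOfRecord F θ.ν θ.τ9.M (histB₁₃ θ K₀ g₀ K) (K₀ + K + 1) (K₀ + K + 1) =>
      classWeightOfDatum₉ F N θ.toStage9Params (datumOfRecord₁₃CoPH F N θ hP) g₀ os (runB₁₃ F K₀ g₀ K) (histB₁₃ θ K₀ g₀ K) (K₀ + K + 1) t s') s hΩ
  refine Eq.trans ?_ h
  refine Finset.sum_congr ?_ fun _ _ => rfl
  ext s'
  simp only [Finset.mem_filter, Finset.mem_univ, true_and, keyB₁₃_eq θ K₀ g₀ hM K s']

/-- **THE CORE OF RECORD IS NON-NEGATIVE AT EVERY KEY** — the sign letter `hP0` of dag-n20-d's `core_crOfRecord₁₃At` at the shell split of record is a THEOREM: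
`0 ≤ weightA₁₃ − shellA₁₃ ρ` at every key, from the core provisos (ζ-rows ⇒ `0 ≤ ζ`, n20-w2's `zeta_nonneg_of_provisos₁₃CoPH`) and F3's displayed (e1) integrability of run A's
top pieces (dag-n21-d's `shellA₁₃_le_weightA₁₃` with its `hζ0` letter discharged). [cite: Balaban1988Convergent, (2.18) p.257; Balaban1989LargeFieldI, p.193 (bookkeeping)] -/
theorem weightA₁₃_sub_shellA₁₃_nonneg (ρ : ℕ → ℝ)
    (hintA : ∀ (K : ℕ) (t : ℝ) (s : SeqOfRecord F θ.ν θ.τ9.M (histA₁₃ θ K₀ g₀ K) (K₀ + K) (K₀ + K)),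
      Integrable (fun V => chiSeqOfRecord F N θ.ν θ.τ9.M (histA₁₃ θ K₀ g₀ K) (K₀ + K) (K₀ + K) s V *
        dressedSlotsOfDatum₉ F N θ.toStage9Params (datumOfRecord₁₃CoPH F N θ hP) g₀ os t (runA₁₃ F K₀ g₀ K) (histA₁₃ θ K₀ g₀ K) (K₀ + K) s V)
        (fieldMeasure (F.P (K₀ + K)) (K₀ + K) (Node00.SU N)))
    (K : ℕ) (t : ℝ) (x : Σ K, SiteSeqKey F (K₀ + K)) :
    0 ≤ weightA₁₃ θ hP K₀ g₀ os K t x - shellA₁₃ θ hP K₀ g₀ os ρ K t x :=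
  sub_nonneg.2 (shellA₁₃_le_weightA₁₃ K₀ θ hP g₀ os (zeta_nonneg_of_provisos₁₃CoPH F θ hP) hintA ρ K t x)

/-- The same for run B (`0 ≤ weightB₁₃ − shellB₁₃ ρ` at every key; dag-n21-d's `shellB₁₃_le_weightB₁₃`). [cite: Balaban1988Convergent, (2.18) p.257; Balaban1989LargeFieldI, p.193 (bookkeeping)] -/
theorem weightB₁₃_sub_shellB₁₃_nonneg (ρ : ℕ → ℝ)
    (hintB : ∀ (K : ℕ) (t : ℝ) (s' : SeqOfRecord F θ.ν θ.τ9.M (histB₁₃ θ K₀ g₀ K) (K₀ + K + 1) (K₀ + K + 1)),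
      Integrable (fun V => chiSeqOfRecord F N θ.ν θ.τ9.M (histB₁₃ θ K₀ g₀ K) (K₀ + K + 1) (K₀ + K + 1) s' V *
        dressedSlotsOfDatum₉ F N θ.toStage9Params (datumOfRecord₁₃CoPH F N θ hP) g₀ os t (runB₁₃ F K₀ g₀ K) (histB₁₃ θ K₀ g₀ K) (K₀ + K + 1) s' V)
        (fieldMeasure (F.P (K₀ + K + 1)) (K₀ + K + 1) (Node00.SU N)))
    (K : ℕ) (t : ℝ) (x : Σ K, SiteSeqKey F (K₀ + K)) :
    0 ≤ weightB₁₃ θ hP K₀ g₀ os K t x - shellB₁₃ θ hP K₀ g₀ os ρ K t x :=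
  sub_nonneg.2 (shellB₁₃_le_weightB₁₃ K₀ θ hP g₀ os (zeta_nonneg_of_provisos₁₃CoPH F θ hP) hintB ρ K t x)

/-! ## §2 At the shell split of record, N19's core edge IS the sandwich of the TERM CORES «(2.18) term minus its own shell part» — run A's `s` vs run B's `liftSeq s` -/

section TermCore

variable (hM : 0 < θ.τ9.M)

/-- **★★ AT THE SHELL SPLIT OF RECORD, N19's CORE EDGE IS THE TERM-CORE SANDWICH — LOSS-FREE.**  For every policy `jcut` (`1 ≤ jcut K ≤ K₀ + K`) and all width
letters `ρA ρB`: `NE7.Core l₀ vol (classSet₁₃ …) (badClass₁₃ … jcut) (weightA₁₃ − shellA₁₃ ρA) (weightB₁₃ − shellB₁₃ ρB) δ` — the hypothesis `h` of dag-n20-d's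
`core_crOfRecord₁₃At` AT `sh := shellSplitOfRecord₁₃At N K₀ ρA ρB` (dag-n21-d), classical instance included — IFF for every `K` ONE constant `c` such that for all `|t| ≤ l₀`
and every run-A (2.18) sequence `s` of `runA₁₃ F K₀ g₀ K` that is small-field at every level `≤ jcut K`:
`e^{c − vol·δ K}·(cw_A(s) − σ_A(s)) ≤ cw_B(liftSeq s) − σ_B(liftSeq s) ≤ e^{c + vol·δ K}·(cw_A(s) − σ_A(s))`, where `cw` = F3's dressed class weight
`classWeightOfDatum₉` and `σ` = dag-n21-d's TERM SHELL PART `shellWeightOfDatum₉` (width `ρA K` at level `K₀ + K`, `ρB K` at level `K₀ + K + 1`) of the two runs at the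
record's datum — module 5's lifted-term sandwich with BOTH keyed shell parts collapsed to TERM shell parts (§1).  DISPLAYED: `hM`, the flow hypothesis `hR`, the policy
letters.  The right-hand side is N19's NE7 core at the record — NOT PRINTED, NOT proved.
[cite: King1986, (3.10) p.656; Balaban1989LargeFieldII, Thm 1 + (0.1) pp.355–356, (1.80) p.384; Balaban1988Convergent, (2.1) p.254, (2.18) p.257; Balaban1989LargeFieldI, p.193 (bookkeeping)] -/
theorem core_shellSplit₁₃_iff_termCore (hR : ∀ K, RAgree F θ.ν (histA₁₃ θ K₀ g₀ K) (histB₁₃ θ K₀ g₀ K) (K₀ + K))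
    (jcut : ℕ → ℕ) (hj1 : ∀ K, 1 ≤ jcut K) (hjK : ∀ K, jcut K ≤ K₀ + K) (ρA ρB : ℕ → ℝ) (l₀ vol : ℝ) (δ : ℕ → ℝ) :
    (letI : DecidableEq (Σ K, SiteSeqKey F (K₀ + K)) := Classical.decEq _
     NE7.Core l₀ vol (classSet₁₃ θ K₀ g₀) (badClass₁₃ θ K₀ g₀ jcut)
       (fun K t x => weightA₁₃ θ hP K₀ g₀ os K t x - shellA₁₃ θ hP K₀ g₀ os ρA K t x)
       (fun K t x => weightB₁₃ θ hP K₀ g₀ os K t x - shellB₁₃ θ hP K₀ g₀ os ρB K t x) δ)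
      ↔ ∀ K : ℕ, ∃ c : ℝ, ∀ t : ℝ, |t| ≤ l₀ → ∀ s : SeqOfRecord F θ.ν θ.τ9.M (histA₁₃ θ K₀ g₀ K) (K₀ + K) (K₀ + K),
          (∀ j, 1 ≤ j → j ≤ jcut K → s.Λ j = Set.univ) →
          Real.exp (c - vol * δ K) *
                (classWeightOfDatum₉ F N θ.toStage9Params (datumOfRecord₁₃CoPH F N θ hP) g₀ os (runA₁₃ F K₀ g₀ K) (histA₁₃ θ K₀ g₀ K) (K₀ + K) t s
                  - shellWeightOfDatum₉ F N θ.toStage9Params (datumOfRecord₁₃CoPH F N θ hP) g₀ os (runA₁₃ F K₀ g₀ K) (histA₁₃ θ K₀ g₀ K) (K₀ + K) (ρA K) t s)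
              ≤ classWeightOfDatum₉ F N θ.toStage9Params (datumOfRecord₁₃CoPH F N θ hP) g₀ os (runB₁₃ F K₀ g₀ K) (histB₁₃ θ K₀ g₀ K) (K₀ + K + 1) t
                    (liftSeq F θ.ν hM (hR K) s)
                  - shellWeightOfDatum₉ F N θ.toStage9Params (datumOfRecord₁₃CoPH F N θ hP) g₀ os (runB₁₃ F K₀ g₀ K) (histB₁₃ θ K₀ g₀ K) (K₀ + K + 1) (ρB K) t
                    (liftSeq F θ.ν hM (hR K) s) ∧
            classWeightOfDatum₉ F N θ.toStage9Params (datumOfRecord₁₃CoPH F N θ hP) g₀ os (runB₁₃ F K₀ g₀ K) (histB₁₃ θ K₀ g₀ K) (K₀ + K + 1) t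
                    (liftSeq F θ.ν hM (hR K) s)
                  - shellWeightOfDatum₉ F N θ.toStage9Params (datumOfRecord₁₃CoPH F N θ hP) g₀ os (runB₁₃ F K₀ g₀ K) (histB₁₃ θ K₀ g₀ K) (K₀ + K + 1) (ρB K) t
                    (liftSeq F θ.ν hM (hR K) s)
              ≤ Real.exp (c + vol * δ K) *
                (classWeightOfDatum₉ F N θ.toStage9Params (datumOfRecord₁₃CoPH F N θ hP) g₀ os (runA₁₃ F K₀ g₀ K) (histA₁₃ θ K₀ g₀ K) (K₀ + K) t s
                  - shellWeightOfDatum₉ F N θ.toStage9Params (datumOfRecord₁₃CoPH F N θ hP) g₀ os (runA₁₃ F K₀ g₀ K) (histA₁₃ θ K₀ g₀ K) (K₀ + K) (ρA K) t s) := by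
  refine (core_reading₁₃_iff_liftedTerm θ hP K₀ g₀ os hM hR jcut hj1 hjK
    (shellA₁₃ θ hP K₀ g₀ os ρA, shellB₁₃ θ hP K₀ g₀ os ρB) l₀ vol δ).trans ?_
  refine forall_congr' fun K => exists_congr fun c => forall_congr' fun t => forall_congr' fun _ => forall_congr' fun s =>
    forall_congr' fun hgood => ?_
  have hΩ : s.Ω 1 = Set.univ := Ω_one_eq_univ_of_smallFieldHistory F θ.ν K₀ (hj1 K) (hjK K) s hgood
  dsimp only
  rw [shellA₁₃_keyA θ hP K₀ g₀ os ρA K t s, shellB₁₃_keyA_of_Ω_one θ hP K₀ g₀ os hM (hR K) ((hj1 K).trans (hjK K)) ρB t s hΩ]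

/-- **★★ THE SAME WITH THE TERM CORES READ AT THE LOWERED THRESHOLD** (dag-n21-d's §3b `classWeight_sub_shellWeight_eq_lowered`: for `0 ≤ ε_k·ρ` the term core
`cw(s) − σ(s)` IS `∫ χ_k^{ε_k(1−ρ)}(Ω_k(s))·slot^t_k(s) dV_k`, the (2.18) term RE-TESTED at the lowered threshold `ε_k(1 − ρ)`).  DISPLAYED in addition: (H-U)
`LocalBgMeasurable` (def-T's front factor at the lowered letter is measurable), the sign of the widths, and F3's (e1) integrability of the two runs' top pieces.  So AT THE SHELL
SPLIT OF RECORD N19's core edge reads: for every `K` ONE `c` with, for all `|t| ≤ l₀` and every small-field-at-old-levels run-A index `s`,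
`e^{c − vol·δ K}·∫ χ^{ε(1−ρA)}(s)·slot_A(s) ≤ ∫ χ^{ε(1−ρB)}(liftSeq s)·slot_B(liftSeq s) ≤ e^{c + vol·δ K}·∫ χ^{ε(1−ρA)}(s)·slot_A(s)` — N19′'s DEFINITE object of record,
term vs lifted term; NOT PRINTED, NOT proved.
[cite: King1986, (3.10) p.656; Balaban1989LargeFieldII, Thm 1 + (0.1) pp.355–356, (1.80) p.384; Balaban1988Convergent, (2.17)–(2.18) p.257; Balaban1989LargeFieldI, p.193 (bookkeeping)] -/
theorem core_shellSplit₁₃_iff_loweredTerm (hR : ∀ K, RAgree F θ.ν (histA₁₃ θ K₀ g₀ K) (histB₁₃ θ K₀ g₀ K) (K₀ + K))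
    (jcut : ℕ → ℕ) (hj1 : ∀ K, 1 ≤ jcut K) (hjK : ∀ K, jcut K ≤ K₀ + K) (ρA ρB : ℕ → ℝ) (l₀ vol : ℝ) (δ : ℕ → ℝ)
    (hU : LocalBgMeasurable F N θ.ν)
    (hρA : ∀ K, 0 ≤ epsOfRecord θ.ν (histA₁₃ θ K₀ g₀ K) (K₀ + K) * ρA K)
    (hρB : ∀ K, 0 ≤ epsOfRecord θ.ν (histB₁₃ θ K₀ g₀ K) (K₀ + K + 1) * ρB K)
    (hintA : ∀ (K : ℕ) (t : ℝ) (s : SeqOfRecord F θ.ν θ.τ9.M (histA₁₃ θ K₀ g₀ K) (K₀ + K) (K₀ + K)),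
      Integrable (fun V => chiSeqOfRecord F N θ.ν θ.τ9.M (histA₁₃ θ K₀ g₀ K) (K₀ + K) (K₀ + K) s V *
        dressedSlotsOfDatum₉ F N θ.toStage9Params (datumOfRecord₁₃CoPH F N θ hP) g₀ os t (runA₁₃ F K₀ g₀ K) (histA₁₃ θ K₀ g₀ K) (K₀ + K) s V)
        (fieldMeasure (F.P (K₀ + K)) (K₀ + K) (Node00.SU N)))
    (hintB : ∀ (K : ℕ) (t : ℝ) (s' : SeqOfRecord F θ.ν θ.τ9.M (histB₁₃ θ K₀ g₀ K) (K₀ + K + 1) (K₀ + K + 1)),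
      Integrable (fun V => chiSeqOfRecord F N θ.ν θ.τ9.M (histB₁₃ θ K₀ g₀ K) (K₀ + K + 1) (K₀ + K + 1) s' V *
        dressedSlotsOfDatum₉ F N θ.toStage9Params (datumOfRecord₁₃CoPH F N θ hP) g₀ os t (runB₁₃ F K₀ g₀ K) (histB₁₃ θ K₀ g₀ K) (K₀ + K + 1) s' V)
        (fieldMeasure (F.P (K₀ + K + 1)) (K₀ + K + 1) (Node00.SU N))) :
    (letI : DecidableEq (Σ K, SiteSeqKey F (K₀ + K)) := Classical.decEq _
     NE7.Core l₀ vol (classSet₁₃ θ K₀ g₀) (badClass₁₃ θ K₀ g₀ jcut)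
       (fun K t x => weightA₁₃ θ hP K₀ g₀ os K t x - shellA₁₃ θ hP K₀ g₀ os ρA K t x)
       (fun K t x => weightB₁₃ θ hP K₀ g₀ os K t x - shellB₁₃ θ hP K₀ g₀ os ρB K t x) δ)
      ↔ ∀ K : ℕ, ∃ c : ℝ, ∀ t : ℝ, |t| ≤ l₀ → ∀ s : SeqOfRecord F θ.ν θ.τ9.M (histA₁₃ θ K₀ g₀ K) (K₀ + K) (K₀ + K),
          (∀ j, 1 ≤ j → j ≤ jcut K → s.Λ j = Set.univ) →
          Real.exp (c - vol * δ K) *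
                (∫ V, chiSeqOfRecordAt F N θ.ν θ.τ9.M (histA₁₃ θ K₀ g₀ K) (K₀ + K) (K₀ + K)
                    (epsOfRecord θ.ν (histA₁₃ θ K₀ g₀ K) (K₀ + K) * (1 - ρA K)) s V *
                  dressedSlotsOfDatum₉ F N θ.toStage9Params (datumOfRecord₁₃CoPH F N θ hP) g₀ os t (runA₁₃ F K₀ g₀ K) (histA₁₃ θ K₀ g₀ K) (K₀ + K) s V
                  ∂fieldMeasure (F.P (K₀ + K)) (K₀ + K) (Node00.SU N))
              ≤ (∫ V, chiSeqOfRecordAt F N θ.ν θ.τ9.M (histB₁₃ θ K₀ g₀ K) (K₀ + K + 1) (K₀ + K + 1)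
                    (epsOfRecord θ.ν (histB₁₃ θ K₀ g₀ K) (K₀ + K + 1) * (1 - ρB K)) (liftSeq F θ.ν hM (hR K) s) V *
                  dressedSlotsOfDatum₉ F N θ.toStage9Params (datumOfRecord₁₃CoPH F N θ hP) g₀ os t (runB₁₃ F K₀ g₀ K) (histB₁₃ θ K₀ g₀ K) (K₀ + K + 1)
                    (liftSeq F θ.ν hM (hR K) s) V
                  ∂fieldMeasure (F.P (K₀ + K + 1)) (K₀ + K + 1) (Node00.SU N)) ∧
            (∫ V, chiSeqOfRecordAt F N θ.ν θ.τ9.M (histB₁₃ θ K₀ g₀ K) (K₀ + K + 1) (K₀ + K + 1)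
                    (epsOfRecord θ.ν (histB₁₃ θ K₀ g₀ K) (K₀ + K + 1) * (1 - ρB K)) (liftSeq F θ.ν hM (hR K) s) V *
                  dressedSlotsOfDatum₉ F N θ.toStage9Params (datumOfRecord₁₃CoPH F N θ hP) g₀ os t (runB₁₃ F K₀ g₀ K) (histB₁₃ θ K₀ g₀ K) (K₀ + K + 1)
                    (liftSeq F θ.ν hM (hR K) s) V
                  ∂fieldMeasure (F.P (K₀ + K + 1)) (K₀ + K + 1) (Node00.SU N))
              ≤ Real.exp (c + vol * δ K) *
                (∫ V, chiSeqOfRecordAt F N θ.ν θ.τ9.M (histA₁₃ θ K₀ g₀ K) (K₀ + K) (K₀ + K)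
                    (epsOfRecord θ.ν (histA₁₃ θ K₀ g₀ K) (K₀ + K) * (1 - ρA K)) s V *
                  dressedSlotsOfDatum₉ F N θ.toStage9Params (datumOfRecord₁₃CoPH F N θ hP) g₀ os t (runA₁₃ F K₀ g₀ K) (histA₁₃ θ K₀ g₀ K) (K₀ + K) s V
                  ∂fieldMeasure (F.P (K₀ + K)) (K₀ + K) (Node00.SU N)) := by
  rw [core_shellSplit₁₃_iff_termCore θ hP K₀ g₀ os hM hR jcut hj1 hjK ρA ρB l₀ vol δ]
  refine forall_congr' fun K => exists_congr fun c => forall_congr' fun t => forall_congr' fun _ => forall_congr' fun s =>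
    forall_congr' fun _ => ?_
  rw [classWeight_sub_shellWeight_eq_lowered F N θ.toStage9Params (datumOfRecord₁₃CoPH F N θ hP) g₀ os (runA₁₃ F K₀ g₀ K) (histA₁₃ θ K₀ g₀ K) (K₀ + K)
      hU (hρA K) t s (hintA K t s),
    classWeight_sub_shellWeight_eq_lowered F N θ.toStage9Params (datumOfRecord₁₃CoPH F N θ hP) g₀ os (runB₁₃ F K₀ g₀ K) (histB₁₃ θ K₀ g₀ K) (K₀ + K + 1)
      hU (hρB K) t _ (hintB K t _)]
  exact Iff.rfl

end TermCore

end Summit.QuantumFields.YangMills.BalabanUVNodes.N20CoreEdgeAtShellSplit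

end
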